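import Summits.ABC.ABC.Theses.FeketeScales
import Literature.NumberTheory.DiophantineGeometry.AbcQualityProofs

/-!
# `SparseGoodScales` (stmt-ABC-2161): hypothesis mutation of `IsABCTriple`

Negative support lemmas for the crux `Summit.ABC.ABC.Theses.FeketeScales.SparseGoodScales`
(cdisprove seat, cycle 1).  The crux quantifies over `IsABCTriple a b c`
(`0 < a ∧ 0 < b ∧ a + b = c ∧ Nat.Coprime a b`) with `rad a b c ≤ R`; we drop one clause at a time.

* `sparseGoodScales_false_without_coprime` — COPRIMALITY is load-bearing: `(2^k, 2^k, 2^{k+1})`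
  has radical `2` and unbounded height, so no scale `R ≥ 2` is good for any `δ`.
* `sparseGoodScales_false_without_sum` — the EQUATION `a + b = c` is load-bearing: `(1, 1, 2^k)`.
* `sparseGoodScalesWithoutPos_of_sparseGoodScales` — POSITIVITY is NOT load-bearing: with
  `a + b = c` and `Nat.Coprime a b`, a zero entry forces `c = 1 ≤ R^{1+δ}`; the positivity-free
  form follows from the crux (and trivially implies it), so any proof may ignore `0 < a`, `0 < b`.
-/

noncomputable section

namespace Summit.ABC.ABC.Theorems.SparseGoodScales.Negative

open Literature.NumberTheory.DiophantineGeometry UniqueFactorizationMonoid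

/-- The crux with COPRIMALITY dropped from `IsABCTriple` (positivity and `a + b = c` kept). -/
def SparseGoodScalesWithoutCoprime : Prop :=
  ∀ δ : ℝ, 0 < δ → ∀ N : ℕ, ∃ R : ℕ, N ≤ R ∧ ∀ a b c : ℕ, 0 < a → 0 < b → a + b = c →
    rad a b c ≤ R → (c : ℝ) ≤ (R : ℝ) ^ (1 + δ)

/-- The crux with the EQUATION `a + b = c` dropped (positivity and coprimality kept). -/
def SparseGoodScalesWithoutSum : Prop :=
  ∀ δ : ℝ, 0 < δ → ∀ N : ℕ, ∃ R : ℕ, N ≤ R ∧ ∀ a b c : ℕ, 0 < a → 0 < b → Nat.Coprime a b →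
    rad a b c ≤ R → (c : ℝ) ≤ (R : ℝ) ^ (1 + δ)

/-- The crux with POSITIVITY dropped (equation and coprimality kept). -/
def SparseGoodScalesWithoutPos : Prop :=
  ∀ δ : ℝ, 0 < δ → ∀ N : ℕ, ∃ R : ℕ, N ≤ R ∧ ∀ a b c : ℕ, a + b = c → Nat.Coprime a b →
    rad a b c ≤ R → (c : ℝ) ≤ (R : ℝ) ^ (1 + δ)

/-- `R² < 2^(R²+1)` in `ℝ`, with the left side written as `R^{1+1}` (`Real.rpow`). [folklore] -/
theorem rpow_two_lt_two_pow (R : ℕ) : (R : ℝ) ^ (1 + (1 : ℝ)) < ((2 ^ (R ^ 2 + 1) : ℕ) : ℝ) := by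
  rw [show (1 : ℝ) + 1 = ((2 : ℕ) : ℝ) by norm_num, Real.rpow_natCast]
  have h : R ^ 2 < 2 ^ (R ^ 2 + 1) :=
    (Nat.lt_two_pow_self).trans (Nat.pow_lt_pow_right (by norm_num) (by omega))
  exact_mod_cast h

/-- **Coprimality is load-bearing**: without it `(2^k, 2^k, 2^{k+1})` (radical `2`, unbounded
height) kills every scale `R ≥ 2`, for every `δ`. [folklore] -/
theorem sparseGoodScales_false_without_coprime : ¬ SparseGoodScalesWithoutCoprime := by
  intro h
  obtain ⟨R, hR2, hR⟩ := h 1 one_pos 2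
  have hrad : rad (2 ^ (R ^ 2)) (2 ^ (R ^ 2)) (2 ^ (R ^ 2 + 1)) = 2 := by
    rw [rad_def, ← pow_add, ← pow_add, radical_pow _ (by omega),
      radical_eq_self_of_prime Nat.prime_two]
  have hb := hR (2 ^ (R ^ 2)) (2 ^ (R ^ 2)) (2 ^ (R ^ 2 + 1)) (by positivity) (by positivity)
    (by ring) (by rw [hrad]; exact hR2)
  exact absurd hb (not_le.mpr (rpow_two_lt_two_pow R))

/-- **The equation `a + b = c` is load-bearing**: without it `(1, 1, 2^k)` (radical `2`,
unbounded third entry) kills every scale `R ≥ 2`, for every `δ`. [folklore] -/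
theorem sparseGoodScales_false_without_sum : ¬ SparseGoodScalesWithoutSum := by
  intro h
  obtain ⟨R, hR2, hR⟩ := h 1 one_pos 2
  have hrad : rad 1 1 (2 ^ (R ^ 2 + 1)) = 2 := by
    rw [rad_def, one_mul, one_mul, radical_pow _ (by omega), radical_eq_self_of_prime Nat.prime_two]
  have hb := hR 1 1 (2 ^ (R ^ 2 + 1)) one_pos one_pos (Nat.coprime_one_left 1)
    (by rw [hrad]; exact hR2)
  exact absurd hb (not_le.mpr (rpow_two_lt_two_pow R))

/-- **Positivity is not load-bearing**: the crux implies its positivity-free form (a zero entry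
with `a + b = c`, `Nat.Coprime a b` forces `c = 1`).  The converse is immediate, so the two forms
are equivalent. [folklore] -/
theorem sparseGoodScalesWithoutPos_of_sparseGoodScales
    (h : Summit.ABC.ABC.Theses.FeketeScales.SparseGoodScales) : SparseGoodScalesWithoutPos := by
  intro δ hδ N
  obtain ⟨R, hNR, hR⟩ := h δ hδ (max N 1)
  refine ⟨R, le_trans (le_max_left _ _) hNR, fun a b c hsum hcop hr => ?_⟩
  have hR1 : (1 : ℝ) ≤ R := by exact_mod_cast le_trans (le_max_right N 1) hNR
  have hone : ((1 : ℕ) : ℝ) ≤ (R : ℝ) ^ (1 + δ) := by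
    rw [Nat.cast_one]; exact Real.one_le_rpow hR1 (by linarith)
  rcases Nat.eq_zero_or_pos a with rfl | ha
  · have hb : b = 1 := (Nat.coprime_zero_left b).mp hcop
    subst hb
    have hc : c = 1 := by omega
    subst hc
    exact hone
  rcases Nat.eq_zero_or_pos b with rfl | hb
  · have ha1 : a = 1 := (Nat.coprime_zero_right a).mp hcop
    subst ha1
    have hc : c = 1 := by omega
    subst hc
    exact hone
  exact hR a b c ⟨ha, hb, hsum, hcop⟩ hr

end Summit.ABC.ABC.Theorems.SparseGoodScales.Negative
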